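import Literature.IUT.HodgeTheaters.InitialThetaDataTorsionClaimsModelProofs
import Literature.IUT.HodgeTheaters.InitialThetaDataCuspNormaliserLaw
import HarnessLib

/-!
# [IUTchI] Def 6.1 (v): the cusp-class law `CuspClassesNormaliserStable` (G-L5t4g3-3 (i), binder `hS`) HOLDS at the
# semidirect claims model `regeom₂` — every `Π_{C_F}`-conjugate of `embK(D_x)` IS `embK(D_x)`; hence the JOINT witness
# «{TorsionMonodromy, ArrowCoveringClaims, hI, hS}» at ONE datum (proof-only companion, part 5 of the JOINT-NV row)

S. Mochizuki, *Inter-universal Teichmüller theory I*, kurims manuscript (May 2020), §6 Definition 6.1 (v) p. 158 l. 25–29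
«One verifies immediately that the subgroup `Aut_±(𝒟^{⊚±}) ⊆ Aut(𝒟^{⊚±}) ⥲ Aut(X̲_K)` contains the subgroup
`Aut_K(X̲_K) ⊆ Aut(X̲_K)` of `K`-linear automorphisms and acts transitively on the cusps of `X̲_K`», (vi) p. 159 l. 4–9 «it
makes sense [cf. [AbsTopI], Lemma 4.5, as well as Remark 1.2.2, (ii), of the present paper] to speak of the set of cusps of
`†𝒟^{⊚±}`, as well as the set of `±`-label classes of cusps `LabCusp^±(†𝒟^{⊚±})` — which, in this case, may be identified
with the set of cusps of `†𝒟^{⊚±}`» — the law `CuspClassesNormaliserStable` is OUR interface form of the statement that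
automorphisms of `𝒟^{⊚±}` act on this set of cusps (cuspidal decomposition groups are permuted; [AbsTopI] Lem 4.5)
([IUTchI] Def 6.1 (v) p.158) [claim: Mochizuki2012, status: disputed] (D-0012 claim key; series status DISPUTED — theorems
about a MODEL of the cell's `π₁`-interface structures; nothing of the series is asserted; no side taken on [IUTchIII]
Cor. 3.12).  (Doc-only v2: the Def 6.1 (v)/(vi) quotations re-cut VERBATIM, with line locators, from the render of record
`HOME/lit/renders/IUTchI-kurims-url-690e7b3c6199` — referee abc-iut-ref-m M20-F5; all declarations byte-identical to
p455619.)

## WHAT (proof-only; 0 definitions)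

At `D₀.regeom₂` (parts 1–4: `InitialThetaDataTorsionClaimsModel{,KLevel,Geometry,Construction,Proofs}.lean`) the images
`embK(D_x) ⊆ Π_{C_F} = (W × E_F[l](F̄)) ⋊ (G_F × {±1})` of the cuspidal decomposition groups are
`{⟨(w, 1), (σ, 1)⟩ : σ ∈ G_K, w ∈ W}` (`x = ε⁰, ε′, ε″`) and `{⟨1, (σ, 1)⟩ : σ ∈ G_K}` (`x = 2ε`); conjugation by ANY
`n = ⟨m, (σ₀, u)⟩ ∈ Π_{C_F}` maps `⟨a, (σ, 1)⟩ ↦ ⟨a, (σ₀σσ₀⁻¹, 1)⟩` when `a` has trivial `E_F[l]`-coordinate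
(`conj_mk_of_snd_eq_one`: `G_K ⊴ G_F` is the kernel of the mod-`l` representation — abc-iut-L5-t8's
`fixesTorsion_conj_iff` — so `σ₀σσ₀⁻¹ ∈ G_K` acts trivially on `N`, and `N` is commutative), hence stabilises every
`embK(D_x)` (`conj_smul_decompMap_regeom₂`).  So abc-iut-L5-t14's law `CuspClassesNormaliserStable` holds at `regeom₂`
with `y := x`, `t := 1` (`cuspClassesNormaliserStable_regeom₂`), and the joint witness of part 4b upgrades to
**`exists_torsionMonodromy_claims_hI_hS`**: `{M, hA, hI, hS}` — three of the four §6 law binders `{hS, hA, hI, ΛBad}`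
of abc-iut-L5-t4's genuine kit `baseKitOfTorsionMonodromy` (abc-iut-L5-lead RULINGS #69) plus the datum `M` — are
JOINTLY INHABITED at one initial Θ-datum with genuine arithmetic.  (RULINGS #68 ask (b): `hS` holds OUTRIGHT at the
model; `CG : CuspGalois` does not exist at any 4-label model and is not a binder of this witness.)

HONEST LABEL.  Statements about a MODEL «[synthetic rank-1 inertia line, ι-fixed, I_{ε′} = I_{ε″}; finite Δ_X; genuine
Galois action on E_F[l]]»; nothing about the genuine `π₁`; typed ≠ inhabited ≠ discharged; instantiated ≠ endorsed; no
side taken on [IUTchIII] Cor. 3.12.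
-/

noncomputable section

namespace Literature.IUT.HodgeTheaters

universe u

namespace TorsionClaimsModel

open Literature.AnabelianGeometry.AbsoluteAnabelian Topology
open TorsionMonodromyModel
open scoped WeierstrassCurve.Affine Classical Pointwise

variable {F : Type u} [Field F] {E : WeierstrassCurve F} {Fbar : Type u} [Field Fbar] [Algebra F Fbar] {l : ℕ}

/-! ## Conjugation in `Π_{C_F} = N ⋊ (G_F × {±1})` -/

/-- The action fixes every element of `N` with trivial `E_F[l]`-coordinate (the inertia line is fixed by everything).
[cite: Mochizuki2012, IUTchI §1 p.37] -/
theorem actN_apply_of_snd_eq_one (q : GalPM F Fbar) {a : N E Fbar l} (ha : a.2 = 1) : actN F E Fbar l q a = a :=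
  Prod.ext rfl (by rw [actN_apply_snd, ha, map_one])

/-- Conjugation by `inr q`: `inr q · ⟨a, p⟩ · (inr q)⁻¹ = ⟨q·a, q p q⁻¹⟩`. [cite: Mochizuki2012, IUTchI Def 3.1 (b) p.61] -/
theorem inr_conj_mk (q : GalPM F Fbar) (a : N E Fbar l) (p : GalPM F Fbar) :
    (SemidirectProduct.inr q : PiC F E Fbar l) * ⟨a, p⟩ * (SemidirectProduct.inr q)⁻¹ =
      ⟨actN F E Fbar l q a, q * p * q⁻¹⟩ := by
  refine SemidirectProduct.ext ?_ ?_
  · rw [SemidirectProduct.mul_left, SemidirectProduct.mul_left, SemidirectProduct.left_inr, one_mul, ← map_inv,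
      SemidirectProduct.left_inr, map_one, mul_one]
    rfl
  · rw [SemidirectProduct.mul_right, SemidirectProduct.mul_right, SemidirectProduct.right_inr, ← map_inv,
      SemidirectProduct.right_inr]

/-- Conjugation by `inl m`: `inl m · ⟨a, p⟩ · (inl m)⁻¹ = ⟨m a (p·m)⁻¹, p⟩`. [cite: Mochizuki2012, IUTchI Def 3.1 (b) p.61] -/
theorem inl_conj_mk (m a : N E Fbar l) (p : GalPM F Fbar) :
    (SemidirectProduct.inl m : PiC F E Fbar l) * ⟨a, p⟩ * (SemidirectProduct.inl m)⁻¹ =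
      ⟨m * a * (actN F E Fbar l p m)⁻¹, p⟩ := by
  refine SemidirectProduct.ext ?_ ?_
  · rw [SemidirectProduct.mul_left, SemidirectProduct.mul_left, SemidirectProduct.left_inl, SemidirectProduct.right_inl,
      map_one, MulAut.one_apply, ← map_inv, SemidirectProduct.left_inl, SemidirectProduct.mul_right,
      SemidirectProduct.right_inl, one_mul, map_inv]
  · rw [SemidirectProduct.mul_right, SemidirectProduct.mul_right, SemidirectProduct.right_inl, one_mul, ← map_inv,
      SemidirectProduct.right_inl, mul_one]

/-- **Conjugation of `⟨a, (σ, 1)⟩` with `a.2 = 1` by an arbitrary `n ∈ Π_{C_F}`**: if `σ' := σ₀ σ σ₀⁻¹` (`σ₀ = n.right.1`) fixes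
the `l`-torsion, then `n ⟨a, (σ, 1)⟩ n⁻¹ = ⟨a, (σ', 1)⟩` (`a` is fixed by the action, `σ'` acts trivially on `N`, `N` is
commutative). [cite: Mochizuki2012, IUTchI Def 6.1 (v) p.158] -/
theorem conj_mk_of_snd_eq_one (n : PiC F E Fbar l) {a : N E Fbar l} (ha : a.2 = 1) (σ : Fbar ≃ₐ[F] Fbar)
    (hfix : FixesTorsion E l (n.right.1 * σ * n.right.1⁻¹)) :
    n * ⟨a, (σ, 1)⟩ * n⁻¹ = ⟨a, (n.right.1 * σ * n.right.1⁻¹, 1)⟩ := by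
  have hq : n.right * (σ, 1) * n.right⁻¹ = (n.right.1 * σ * n.right.1⁻¹, 1) :=
    Prod.ext rfl (by rw [Prod.snd_mul, Prod.snd_mul, Prod.snd_inv, mul_one, mul_inv_cancel])
  conv_lhs => rw [← SemidirectProduct.inl_left_mul_inr_right n]
  rw [mul_inv_rev]
  calc SemidirectProduct.inl n.left * SemidirectProduct.inr n.right * ⟨a, (σ, 1)⟩ *
        ((SemidirectProduct.inr n.right)⁻¹ * (SemidirectProduct.inl n.left)⁻¹)
      = SemidirectProduct.inl n.left * (SemidirectProduct.inr n.right * ⟨a, (σ, 1)⟩ *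
          (SemidirectProduct.inr n.right)⁻¹) * (SemidirectProduct.inl n.left)⁻¹ := by simp only [mul_assoc]
    _ = SemidirectProduct.inl n.left * ⟨a, (n.right.1 * σ * n.right.1⁻¹, 1)⟩ * (SemidirectProduct.inl n.left)⁻¹ := by
        rw [inr_conj_mk, actN_apply_of_snd_eq_one _ ha, hq]
    _ = ⟨a, (n.right.1 * σ * n.right.1⁻¹, 1)⟩ := by
        rw [inl_conj_mk, actN_apply_of_fixesTorsion E Fbar l hfix, mul_comm n.left a, mul_inv_cancel_right]

end TorsionClaimsModel

/-! ## At `regeom₂`: every cuspidal class is `Π_{C_F}`-stable; `CuspClassesNormaliserStable`; the joint witness -/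

namespace InitialThetaData

open TorsionMonodromyModel TorsionClaimsModel
open scoped WeierstrassCurve.Affine Classical Pointwise

variable {F K Fbar : Type u} [Field F] [NumberField F] [Field K] [NumberField K] [Algebra F K] [Field Fbar]
  [Algebra F Fbar] [Algebra K Fbar] {E : WeierstrassCurve F} [E.IsElliptic] {l : ℕ} {Pb : BadPlacePredicates K}

/-- **Every `Π_{C_F}`-conjugate of an element of `embK(D_x)` lies in `embK(D_x)`** at `regeom₂` (any cusp label `x`, any
`n ∈ Π_{C_F}`): `embK(D_x) = {⟨(w, 1), (σ, 1)⟩}` resp. `{⟨1, (σ, 1)⟩}` (`σ ∈ G_K`) and `G_K ⊴ G_F` fixes `N`.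
[cite: Mochizuki2012, IUTchI Def 6.1 (v) p.158] -/
theorem conj_mem_decompMap_regeom₂ (D₀ : InitialThetaData F K Fbar E l Pb) (x : D₀.regeom₂.geom.pe.Cusp)
    (n : D₀.regeom₂.PiC) {s : D₀.regeom₂.PiC}
    (hs : s ∈ (D₀.regeom₂.geom.pe.decomp x).map D₀.regeom₂.geom.embK) :
    n * s * n⁻¹ ∈ (D₀.regeom₂.geom.pe.decomp x).map D₀.regeom₂.geom.embK := by
  haveI := D₀.isAlgClosure
  haveI := D₀.isScalarTower
  haveI : NeZero l := ⟨D₀.l_prime.ne_zero⟩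
  haveI : CompactSpace (galoisSubgroupOf F K Fbar) :=
    isCompact_iff_compactSpace.mp (ThetaGeometryModel.isClosed_galoisSubgroupOf F K Fbar).isCompact
  suffices main : ∀ (n' : TorsionClaimsModel.PiC F E Fbar l) {s' : TorsionClaimsModel.PiC F E Fbar l},
      s' ∈ ((TorsionClaimsModel.pedOf (galoisSubgroupOf F K Fbar) D₀.lineGen D₀.five_le_l
        (coprime_six_of_prime l D₀.l_prime D₀.five_le_l)).decomp x).map
        (TorsionClaimsModel.embK D₀.fixesTorsion_of_mem_galoisSubgroupOf) →
      n' * s' * n'⁻¹ ∈ ((TorsionClaimsModel.pedOf (galoisSubgroupOf F K Fbar) D₀.lineGen D₀.five_le_l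
        (coprime_six_of_prime l D₀.l_prime D₀.five_le_l)).decomp x).map
        (TorsionClaimsModel.embK D₀.fixesTorsion_of_mem_galoisSubgroupOf) from main n hs
  intro n' s' hs'
  obtain ⟨y, hy, rfl⟩ := hs'
  -- `y.2 ∈ dW` in both cases (`D_{2ε} = G × 1 ≤ G × dW`)
  have hdec : ∀ {z z' : galoisSubgroupOf F K Fbar × TorsionClaimsModel.Dih E Fbar l}, z.2 = z'.2 →
      z ∈ (TorsionClaimsModel.pedOf (galoisSubgroupOf F K Fbar) D₀.lineGen D₀.five_le_l
        (coprime_six_of_prime l D₀.l_prime D₀.five_le_l)).decomp x →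
      z' ∈ (TorsionClaimsModel.pedOf (galoisSubgroupOf F K Fbar) D₀.lineGen D₀.five_le_l
        (coprime_six_of_prime l D₀.l_prime D₀.five_le_l)).decomp x ∧ z.2 ∈ TorsionClaimsModel.Dih.dW F E := by
    intro z z' hzz hz
    by_cases hx : x = ⟨3⟩
    · subst hx
      have h1 : z.2 ∈ (⊥ : Subgroup (TorsionClaimsModel.Dih E Fbar l)) :=
        TorsionClaimsModel.mem_lift.mp ((TorsionClaimsModel.pedOf_decomp_twoε _ _ _ _).le hz)
      refine ⟨(TorsionClaimsModel.pedOf_decomp_twoε _ _ _ _).ge (TorsionClaimsModel.mem_lift.mpr ?_), ?_⟩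
      · rw [← hzz]; exact h1
      · rw [Subgroup.mem_bot.mp h1]; exact one_mem _
    · have h1 : z.2 ∈ TorsionClaimsModel.Dih.dW F E :=
        TorsionClaimsModel.mem_lift.mp ((TorsionClaimsModel.pedOf_decomp_of_ne _ _ _ _ hx).le hz)
      refine ⟨(TorsionClaimsModel.pedOf_decomp_of_ne _ _ _ _ hx).ge (TorsionClaimsModel.mem_lift.mpr ?_), h1⟩
      rw [← hzz]; exact h1
  obtain ⟨hyr, hy2⟩ := (TorsionClaimsModel.Dih.mem_dW_iff _).mp (hdec (z := y) (z' := y) rfl hy).2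
  -- the conjugating Galois element `σ' = σ₀ σ σ₀⁻¹` stays in `G_K`
  set σ' : Fbar ≃ₐ[F] Fbar := n'.right.1 * (y.1 : Fbar ≃ₐ[F] Fbar) * n'.right.1⁻¹ with hσ'
  have hfix : FixesTorsion E l σ' := by
    rw [hσ', fixesTorsion_conj_iff]
    exact (D₀.mem_galoisSubgroupOf_iff_fixesTorsion _).mp y.1.2
  have hσ'K : σ' ∈ galoisSubgroupOf F K Fbar := (D₀.mem_galoisSubgroupOf_iff_fixesTorsion _).mpr hfix
  have hs' : TorsionClaimsModel.embK D₀.fixesTorsion_of_mem_galoisSubgroupOf y =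
      (⟨y.2.left, ((y.1 : Fbar ≃ₐ[F] Fbar), 1)⟩ : TorsionClaimsModel.PiC F E Fbar l) :=
    SemidirectProduct.ext rfl (Prod.ext rfl hyr)
  have hconj := TorsionClaimsModel.conj_mk_of_snd_eq_one n' hy2 (y.1 : Fbar ≃ₐ[F] Fbar) hfix
  refine ⟨(⟨σ', hσ'K⟩, y.2), (hdec (z := y) (z' := (⟨σ', hσ'K⟩, y.2)) rfl hy).1, ?_⟩
  rw [hs', hconj]
  exact SemidirectProduct.ext rfl (Prod.ext rfl hyr)

/-- **Every cuspidal class `embK(D_x)` is `Π_{C_F}`-STABLE at `regeom₂`**: `n · embK(D_x) · n⁻¹ = embK(D_x)` for every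
`n ∈ Π_{C_F}` (not only for the normaliser of `Π_{X̲_K}`). [cite: Mochizuki2012, IUTchI Def 6.1 (v) p.158] -/
theorem conj_smul_decompMap_regeom₂ (D₀ : InitialThetaData F K Fbar E l Pb) (x : D₀.regeom₂.geom.pe.Cusp)
    (n : D₀.regeom₂.PiC) :
    MulAut.conj n • ((D₀.regeom₂.geom.pe.decomp x).map D₀.regeom₂.geom.embK) =
      (D₀.regeom₂.geom.pe.decomp x).map D₀.regeom₂.geom.embK := by
  refine le_antisymm (fun z hz => ?_) (fun z hz => ?_)
  · have h := Subgroup.mem_pointwise_smul_iff_inv_smul_mem.mp hz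
    rw [MulAut.smul_def, MulAut.conj_inv_apply] at h
    have h2 := D₀.conj_mem_decompMap_regeom₂ x n h
    have : n * (n⁻¹ * z * n) * n⁻¹ = z := by group
    rwa [this] at h2
  · refine Subgroup.mem_pointwise_smul_iff_inv_smul_mem.mpr ?_
    rw [MulAut.smul_def, MulAut.conj_inv_apply]
    have h2 := D₀.conj_mem_decompMap_regeom₂ x n⁻¹ hz
    rwa [inv_inv] at h2

/-- **G-L5t4g3-3 (i) `CuspClassesNormaliserStable` (binder `hS`) HOLDS at `regeom₂`** — with `y := x` and `t := 1`: every
automorphism-of-`𝒟^{⊚±}` candidate `n` (indeed every `n ∈ Π_{C_F}`) fixes each cuspidal class.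
[cite: Mochizuki2012, IUTchI Def 6.1 (v) p.158] -/
theorem cuspClassesNormaliserStable_regeom₂ (D₀ : InitialThetaData F K Fbar E l Pb) :
    D₀.regeom₂.CuspClassesNormaliserStable :=
  ⟨fun n _ x => ⟨x, 1, one_mem _, by rw [one_mul]; exact D₀.conj_smul_decompMap_regeom₂ x n⟩⟩

/-- **JOINT NON-VACUITY of `{M : TorsionMonodromy, hA : ArrowCoveringClaims, hI, hS : CuspClassesNormaliserStable}`** at
ONE initial Θ-datum with the arithmetic of `D₀` (`D := D₀.regeom₂`, `M := D₀.torsionMonodromyRegeom₂`): three of the four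
§6 law binders `{hS, hA, hI, ΛBad}` of abc-iut-L5-t4's genuine kit `baseKitOfTorsionMonodromy` (p446463) and the datum `M`
are jointly inhabited (abc-iut-L5-lead RULINGS #68/#69).  Tag «[model: synthetic rank-1 inertia line, ι-fixed,
I_{ε′} = I_{ε″}; finite Δ_X; genuine Galois action on E_F[l]]»; inhabited ≠ discharged.
[cite: Mochizuki2012, IUTchI Def 6.1 (v) p.158] -/
theorem exists_torsionMonodromy_claims_hI_hS (D₀ : InitialThetaData F K Fbar E l Pb) :
    ∃ D : InitialThetaData F K Fbar E l Pb, D.VbadMod = D₀.VbadMod ∧ D.V = D₀.V ∧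
      D.CuspClassesNormaliserStable ∧ D.geom.pe.ArrowCoveringClaims ∧
      ∃ M : D.TorsionMonodromy, ∀ x : D.geom.pe.Cusp, ∀ k ∈ D.geom.pe.inertia x, M.tau (D.geom.embK k) = 0 :=
  ⟨D₀.regeom₂, rfl, rfl, D₀.cuspClassesNormaliserStable_regeom₂, D₀.arrowCoveringClaims_regeom₂,
    D₀.torsionMonodromyRegeom₂, D₀.tau_inertia_regeom₂⟩

end InitialThetaData

end Literature.IUT.HodgeTheaters

end
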